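import Mathlib
import Literature.NumberTheory.LFunctions.Zhang2022.TypedSection16B
import HarnessLib

/-!
# Zhang (2022) §16 pp. 93–94, (16.13)→(16.15): the LOCAL factor `ϖ₂ⱼ^loc` of `ϖ₂ⱼ` and the Block-A
# displays u031–u037 READ with it at the `𝔮`-rough arguments (finding F16B-1 of the ZHANG-L lane) —
# typed statements + the ported bookkeeping edge to (16.15)

Topic `Literature/NumberTheory/LFunctions/Zhang2022` (Landau–Siegel audit tree; verdict-neutral).
Y. Zhang, *Discrete mean estimates and the Landau–Siegel zero*, arXiv:2211.02515v1 (2022)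
[Zhang2022LandauSiegel] — **an unrefereed manuscript under adjudication. Every `def … : Prop` below is a
READING of a displayed step of §16 (pp. 93–94, tex L4597–L4633), STATED NOT ASSERTED; nothing here
asserts or denies Theorems 1–2 of the source or says anything about Landau–Siegel zeros.** Companion of
`TypedSection16B` (whose objects `varpi2`, `b1coef`, `calM2Factor`, `lam2`, `varrhoStar`, `frake`, `nset`,
`frakq`, `tau3R`, `nuConvChi`, … are used BY NAME; nothing is restated).

## Why (finding F16B-1, ZHANG-L WP16 typer, 2026-08-26; numbers, not adjectives)

`ϖ₂ⱼ(n) = Σ_{n=dl} λ₂(d)d^{β_j}χ(l)𝓜₂(d,l;1−β_j)/𝓜₂*(1−β_j)` (§16 p. 93, tex L4597; `Typed.Section16B.varpi2`)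
is normalised by `𝓜₂*`, which for `χ(2) = 1` is `2∏_{q>2}[q-factor of 𝓜₂(1,1;·)]` (u026,
`Section16A.calM2star`) — the `q = 2` Euler factor of `𝓜₂(1,1;s)`, `F₂(1,1,s) = calM2Factor c′ χ 2 1 1 s`,
tends to `frakpFactor χ 2 = (1 − ½)⁻¹(1 − 1/(2−1)) = 0` as `s → 1`, `β₁ → 0` (tree:
`AppendixA.calM2Factor_prime_one_one`, `AppendixA.frakpFactor_eq_locMain`). Hence for ODD `n` (in
particular every `n` coprime to `𝔮 = ∏_{q<D⁴} q`) each summand of `varpi2 c′ χ j n` carries the global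
factor `ρ := F₂(1,1,1−β_j)/2 ≈ 0` when `χ(2) = 1`, and the manuscript's "Note that `ϖ₂ⱼ(n)` is
multiplicative" (tex L4599) holds only in the form `ϖ₂ⱼ(n₁n) = ϖ₂ⱼ(n₁)·ϖ₂ⱼ^loc(n)` (`n` rough, coprime
to `n₁`) with the LOCAL factor `ϖ₂ⱼ^loc` below (`ϖ₂ⱼ^loc(1) = 1`, whereas `ϖ₂ⱼ(1) = ρ`). The manuscript
itself records the phenomenon in App. A (proof of Lemma 16.2, tex L5229–5236): «`𝓜₂(d,l;s)/𝓜₂*(s) =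
Π₂(l) + O(α₁τ₂(dl))` … `Π₂(l) = 0` if `χ(2) = (l,2) = 1`». Consequently the typed Block-A displays that
evaluate `varpi2` at ROUGH arguments — `Step16_u031`, `Step16_u033`, `Step16_u034`, `Step16_u035`,
`Inline16_innerSum1614`, `Step16_u037`, `Step16_u037R` — are, in the branch `χ(2) = 1`, off by the factor
`ρ` on exactly one side (u034 at `m = 1` reads `‖ρ − 1‖ ≤ C·D^{−c}`), so the edge
`eq16_15_of_repair : Step16_u031 → Step16_u037R → Inline16_varpi2WeightSum → Eq16_15` (p413944) cannot
be fed by proofs of its hypotheses as typed ((A)-guarded, so nothing is kernel-refuted either). The nodes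
`Eq16_14` (both sides `ρ`-scaled), `Step16_u036` (an upper bound), and everything from (16.15) upward
(`Eq16_15`, `Inline16_varpi2WeightSum`, `Inline16_nsetRemovable`, u040–(16.16), `Eq16_16R2`) are unaffected.

## What is here

* OBJECTS: `locRatio c′ χ q d l s = F_q(d,l,s)/F_q(1,1,s)` (the `q`-local ratio of Euler factors of
  `𝓜₂(d,l;·)` against `𝓜₂(1,1;·)`; `F_q = Section16A.calM2Factor`, which depends on `(d,l)` only through
  `[q∣d], [q∣l]` — tree `AppendixA.xi2LocalSeries_prime`, `AppendixA.lamTilde2_prime`), and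
  `varpi2loc c′ χ j n = Σ_{n=dl} λ₂(d)d^{β_j}χ(l)∏_{q∣n} locRatio q d l (1−β_j)` (`ϖ₂ⱼ^loc`).
* CLAIMS (readings, suffix `L` = "`varpi2 ↦ varpi2loc` at the rough arguments ONLY; the smooth-part
  factor `ϖ₂ⱼ(n₁)` stays the true object"): `Step16_u031L`, `Step16_u033L`, `Step16_u034L`,
  `Step16_u035Lw` (the rate Lemma 15.1 + u034 give, `C(α𝓛 + 𝓛⁻⁷)τ₂(m₁)`, = WP16-PLAN
  Sketch S5; the printed `O(D^{−c})` of u035 is not re-typed), `Eq16_14L`, `Step16_u036L`, `Inline16_innerSum1614L`,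
  `Step16_u037RL`.
* KERNEL (0 facts): `varpi2loc_one` (`ϖ₂ⱼ^loc(1) = 1`) and the ported edge
  `eq16_15_of_repairL : Step16_u031L → Step16_u037RL → Inline16_varpi2WeightSum → Eq16_15` (the algebra
  of `eq16_15_of_repair`, verbatim, with the inner rough sum read through `varpi2loc`).
* NOT here (prover work): the multiplicativity lemma `ϖ₂ⱼ(n₁n) = ϖ₂ⱼ(n₁)ϖ₂ⱼ^loc(n)` (needs the
  multipliability of `∏_q F_q(1,1,1−β_j)` — Lemma 16.1 machinery — and the locality of `F_q`), and the
  proofs of the `L` nodes.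

Conventions as in `TypedSection16B` (`ForAllLarge` + (A); `O(D^{−c})` ↦ `∃ c > 0, ∃ C, …`; `j = 1, 2`; finite
ranges as there). No instance, no notation. Naming: `L` for "local reading"; docstrings name F16B-1.

## References

* Y. Zhang, arXiv:2211.02515v1 (2022), §16 pp. 93–94 (tex L4597–L4637), (16.13)–(16.15); App. A,
  proof of Lemma 16.2, p. 105 (tex L5225–L5237); §15 Lemma 15.1, (15.20)–(15.21).
  [cite: Zhang2022LandauSiegel, §16 pp.93–94]
-/

noncomputable section

open Complex Real ComplexConjugate Filter Topology
open Literature.NumberTheory.LFunctions.Zhang2022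
open Literature.NumberTheory.LFunctions.Zhang2022.Skeleton
open Literature.NumberTheory.LFunctions.Zhang2022.Typed.Section16A

namespace Literature.NumberTheory.LFunctions.Zhang2022.Typed.Section16B

variable (c' : ℝ)

/-! ## The local objects -/

section LocalObjects

variable {D : ℕ} [NeZero D] (χ : DirichletCharacter ℂ D)

/-- **The `q`-local ratio `F_q(d,l,s)/F_q(1,1,s)`** of the Euler factors of `𝓜₂(d,l;s)` and `𝓜₂(1,1;s)`
(`F_q = Section16A.calM2Factor`; App. A p. 105: the factor by which the two products differ at a prime
`q ∣ dl`; equal to `1` when `q ∤ dl`, since `F_q(d,l,·)` depends on `(d,l)` only through `[q∣d], [q∣l]`).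
[cite: Zhang2022LandauSiegel, §16 p.93, App. A p.105] -/
def locRatio (q d l : ℕ) (s : ℂ) : ℂ := calM2Factor c' χ q d l s / calM2Factor c' χ q 1 1 s

/-- **`ϖ₂ⱼ^loc(n) = Σ_{n=dl} λ₂(d)d^{β_j}χ(l)∏_{q∣n} F_q(d,l,1−β_j)/F_q(1,1,1−β_j)`** — the LOCAL
(multiplicative, `ϖ₂ⱼ^loc(1) = 1`) factor of `ϖ₂ⱼ`: for `n` coprime to `n₁` and to the primes where
`F_q(1,1,1−β_j) = 0` one has `ϖ₂ⱼ(n₁n) = ϖ₂ⱼ(n₁)·ϖ₂ⱼ^loc(n)` — the content of "Note that `ϖ₂ⱼ(n)` is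
multiplicative" (§16 p. 93, tex L4599) that the displays u031–u037 use at the `𝔮`-rough arguments
(finding F16B-1: for `χ(2) = 1` the globally normalised `varpi2` differs from it there by the factor
`F₂(1,1,1−β_j)/2 ≈ 0`). NOT PRINTED as a separate symbol. [cite: Zhang2022LandauSiegel, §16 p.93] -/
def varpi2loc (j n : ℕ) : ℂ :=
  ∑ x ∈ n.divisorsAntidiagonal,
    lam2 c' χ x.1 1 * (x.1 : ℂ) ^ betaJ c' D j * χ (x.2 : ZMod D) *
      ∏ q ∈ n.primeFactors, locRatio c' χ q x.1 x.2 (1 - betaJ c' D j)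

omit [NeZero D] in
/-- `ϖ₂ⱼ^loc(1) = 1` (the local object is normalised; contrast `ϖ₂ⱼ(1) = 𝓜₂(1,1;1−β_j)/𝓜₂*(1−β_j)`).
[cite: Zhang2022LandauSiegel, §16 p.93] -/
theorem varpi2loc_one (j : ℕ) : varpi2loc c' χ j 1 = 1 := by
  unfold varpi2loc
  rw [Nat.divisorsAntidiagonal_one, Finset.sum_singleton]
  simp [lam2]

end LocalObjects

/-! ## The Block-A displays READ with `ϖ₂ⱼ^loc` at the rough arguments (suffix `L`; F16B-1) -/

open scoped Classical in
/-- **u031 (display after (16.13), tex L4602), local reading**: "`Σ_n b₁(n)ϖ₂ⱼ(n)/n =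
Σ_{n₁∈𝔫(𝔮), n₁<T} ϖ₂ⱼ(n₁)/n₁ · Σ_{(n,𝔮)=1} b₁(n₁n)ϖ₂ⱼ^loc(n)/n + O(D^{−c})`" — `Step16_u031` with the
inner (rough) `ϖ₂ⱼ` read as `varpi2loc` (the outer `ϖ₂ⱼ(n₁)` IS `varpi2`). NOT PRINTED in this form
(F16B-1 reading). CLAIM. [cite: Zhang2022LandauSiegel, §16 p.93] -/
def Step16_u031L : Prop :=
  ∃ c : ℝ, 0 < c ∧ ∃ C : ℝ, ForAllLarge fun D _ χ => AssumptionA D χ → ∀ j ∈ ({1, 2} : Finset ℕ),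
    ‖(∑ n ∈ Finset.Ico 1 ⌈bigP D⌉₊, b1coef c' χ n * varpi2 c' χ j n / (n : ℂ)) -
        ∑ n₁ ∈ (Finset.Ico 1 ⌈bigT D⌉₊).filter (fun n₁ => n₁ ∈ nset (frakq D)),
          varpi2 c' χ j n₁ / (n₁ : ℂ) *
            ∑ n ∈ (Finset.Ico 1 ⌈bigP D⌉₊).filter (fun n => Nat.Coprime n (frakq D)),
              b1coef c' χ (n₁ * n) * varpi2loc c' χ j n / (n : ℂ)‖ ≤
      C * (D : ℝ) ^ (-c)

/-- **u033 (third display after (16.13), tex L4610), local reading**: for `n₁ ∈ 𝔫(𝔮)`, `n₁ < T`,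
"`Σ_{(n,𝔮)=1} b₁(n₁n)ϖ₂ⱼ^loc(n)/n = Σ_{n₁=l₁m₁} Σ_{(l,𝔮)=1} ϖ₂ⱼ^loc(l)/(l(l₁l)^{β₃}) g*(T²/(l₁l))
Σ_{(m,𝔮)=1} b(m₁m)χ(m₁m)ϖ₂ⱼ^loc(m)/m + O(D^{−c})`" (`b(m₁m)` in the χ-twisted reading, G-L4t1-1, as in
`Step16_u033`). NOT PRINTED in this form (F16B-1). CLAIM. [cite: Zhang2022LandauSiegel, §16 p.93] -/
def Step16_u033L : Prop :=
  ∃ c : ℝ, 0 < c ∧ ∃ C : ℝ, ForAllLarge fun D _ χ => AssumptionA D χ → ∀ j ∈ ({1, 2} : Finset ℕ),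
    ∀ n₁ : ℕ, n₁ ∈ nset (frakq D) → (n₁ : ℝ) < bigT D →
      ‖(∑ n ∈ (Finset.Ico 1 ⌈bigP D⌉₊).filter (fun n => Nat.Coprime n (frakq D)),
          b1coef c' χ (n₁ * n) * varpi2loc c' χ j n / (n : ℂ)) -
        ∑ x ∈ n₁.divisorsAntidiagonal,
          ∑ l ∈ (Finset.Ico 1 ⌈2 * bigT D ^ 2⌉₊).filter (fun l => Nat.Coprime l (frakq D)),
            varpi2loc c' χ j l / ((l : ℂ) * (((x.1 * l : ℕ) : ℂ)) ^ beta3 c' D) *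
              (gstar D (bigT D ^ 2 / ((x.1 * l : ℕ) : ℝ)) : ℂ) *
              ∑ m ∈ (Finset.Ico 1 ⌈bigP D⌉₊).filter (fun m => Nat.Coprime m (frakq D)),
                bcoef D (x.2 * m) * χ ((x.2 * m : ℕ) : ZMod D) * varpi2loc c' χ j m / (m : ℂ)‖ ≤
      C * (D : ℝ) ^ (-c)

/-- **u034 (fourth display after (16.13), tex L4615), local reading**: "for `(m,𝔮) = 1` and `m < P` we
have trivially `ϖ₂ⱼ^loc(m) = χ(m)ϱ*ⱼ(m) + O(τ₂(m)D^{−c})`" (`ϱ*ⱼ = Skeleton.varrhoStar`). With the global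
`varpi2` this is false for `χ(2) = 1` (at `m = 1`: `‖ρ − 1‖ ≤ CD^{−c}`); with `varpi2loc` it is the local
comparison at primes `q ≥ D⁴`. NOT PRINTED in this form (F16B-1). CLAIM. [cite: Zhang2022LandauSiegel, §16 p.93] -/
def Step16_u034L : Prop :=
  ∃ c : ℝ, 0 < c ∧ ∃ C : ℝ, ForAllLarge fun D _ χ => AssumptionA D χ → ∀ j ∈ ({1, 2} : Finset ℕ),
    ∀ m : ℕ, 1 ≤ m → Nat.Coprime m (frakq D) → (m : ℝ) < bigP D →
      ‖varpi2loc c' χ j m - χ (m : ZMod D) * varrhoStar c' χ j m‖ ≤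
        C * m.divisors.card * (D : ℝ) ^ (-c)

/-- **u035 (fifth display after (16.13), tex L4619), local reading, with the rate Lemma 15.1 (χ-reading)
and u034 actually give**: for `m₁ ∈ 𝔫(𝔮)`, `m₁ < T`, `Σ_{(m,𝔮)=1} b(m₁m)χ(m₁m)ϖ₂ⱼ^loc(m)/m =
𝔢ⱼχ(m₁)τ₂(m₁) + O((α𝓛 + 𝓛⁻⁷)τ₂(m₁))` (χ-twisted `b`, G-L4t1-1) — the conclusion of WP16-PLAN Sketch S5
(`step16_u035w_of_lemma151Chi`) with `ϖ₂ⱼ^loc`; (16.14)/u037R absorb it (`α𝓛 = π𝓛⁻⁸`). The printed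
rate `O(D^{−c})` (`Step16_u035`, flagged there) is not re-typed here. NOT PRINTED. CLAIM.
[cite: Zhang2022LandauSiegel, §16 p.93; §15 Lemma 15.1] -/
def Step16_u035Lw : Prop :=
  ∃ C : ℝ, ForAllLarge fun D _ χ => AssumptionA D χ → ∀ j ∈ ({1, 2} : Finset ℕ),
    ∀ m₁ : ℕ, m₁ ∈ nset (frakq D) → (m₁ : ℝ) < bigT D →
      ‖(∑ m ∈ (Finset.Ico 1 ⌈bigP D⌉₊).filter (fun m => Nat.Coprime m (frakq D)),
          bcoef D (m₁ * m) * χ ((m₁ * m : ℕ) : ZMod D) * varpi2loc c' χ j m / (m : ℂ)) -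
        frake j * χ (m₁ : ZMod D) * (m₁.divisors.card : ℂ)‖ ≤
        C * (alpha D * ell D + (ell D ^ 7)⁻¹) * m₁.divisors.card

/-- **(16.14) (tex L4623), local reading**: for `n₁ ∈ 𝔫(𝔮)`, `n₁ < T`:
"`Σ_{(n,𝔮)=1} b₁(n₁n)ϖ₂ⱼ^loc(n)/n = 𝔢ⱼ Σ_{n₁=l₁m₁} χ(m₁)τ₂(m₁) Σ_{(l,𝔮)=1} ϖ₂ⱼ^loc(l)/(l(l₁l)^{β₃})
g*(T²/(l₁l)) + O(D^{−c})`" (the printed `Eq16_14` with the global `varpi2` is the same statement scaled by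
`ρ` on both sides). NOT PRINTED in this form (F16B-1). CLAIM. [cite: Zhang2022LandauSiegel, §16 (16.14) p.93] -/
def Eq16_14L : Prop :=
  ∃ c : ℝ, 0 < c ∧ ∃ C : ℝ, ForAllLarge fun D _ χ => AssumptionA D χ → ∀ j ∈ ({1, 2} : Finset ℕ),
    ∀ n₁ : ℕ, n₁ ∈ nset (frakq D) → (n₁ : ℝ) < bigT D →
      ‖(∑ n ∈ (Finset.Ico 1 ⌈bigP D⌉₊).filter (fun n => Nat.Coprime n (frakq D)),
          b1coef c' χ (n₁ * n) * varpi2loc c' χ j n / (n : ℂ)) -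
        frake j * ∑ x ∈ n₁.divisorsAntidiagonal, χ (x.2 : ZMod D) * (x.2.divisors.card : ℂ) *
          ∑ l ∈ (Finset.Ico 1 ⌈2 * bigT D ^ 2⌉₊).filter (fun l => Nat.Coprime l (frakq D)),
            varpi2loc c' χ j l / ((l : ℂ) * (((x.1 * l : ℕ) : ℂ)) ^ beta3 c' D) *
              (gstar D (bigT D ^ 2 / ((x.1 * l : ℕ) : ℝ)) : ℂ)‖ ≤
      C * (D : ℝ) ^ (-c)

/-- **u036 (display after (16.14), tex L4627), local reading**: "if `1 < l < T⁵` and `(l,𝔮) = 1`, then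
for any `q ∣ l`, `ϖ₂ⱼ^loc(l) ≪ α₁ + O(ν(q))`" (`α₁ ↦ α𝓛`; glyph `ϱ₂ⱼ` of the print read `ϖ₂ⱼ` as in
`Step16_u036`, which — an upper bound — also survives with the global `varpi2`). NOT PRINTED in this
form (F16B-1). CLAIM. [cite: Zhang2022LandauSiegel, §16 p.93] -/
def Step16_u036L : Prop :=
  ∃ C : ℝ, ForAllLarge fun D _ χ => AssumptionA D χ → ∀ j ∈ ({1, 2} : Finset ℕ),
    ∀ l : ℕ, 1 < l → (l : ℝ) < bigT D ^ 5 → Nat.Coprime l (frakq D) → ∀ q : ℕ, q.Prime → q ∣ l →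
      ‖varpi2loc c' χ j l‖ ≤ C * (alpha D * ell D + ‖nu χ q‖)

/-- **"the innermost sum in (16.14) is `1 + O(1/𝓛⁷)`" (tex L4631), local reading**: for `n₁ ∈ 𝔫(𝔮)`,
`n₁ < T`, `l₁ ∣ n₁`: `Σ_{(l,𝔮)=1} ϖ₂ⱼ^loc(l)/(l(l₁l)^{β₃}) g*(T²/(l₁l)) = 1 + O(𝓛⁻⁷)` (the `l = 1` term is
`ϖ₂ⱼ^loc(1)·g*(T²/l₁)·l₁^{−β₃} = 1 + O(α𝓛^{1.1})`; with the global `varpi2` the sum is `ρ`-scaled and the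
claim fails for `χ(2) = 1`). NOT PRINTED in this form (F16B-1). CLAIM. [cite: Zhang2022LandauSiegel, §16 p.94] -/
def Inline16_innerSum1614L : Prop :=
  ∃ C : ℝ, ForAllLarge fun D _ χ => AssumptionA D χ → ∀ j ∈ ({1, 2} : Finset ℕ),
    ∀ n₁ : ℕ, n₁ ∈ nset (frakq D) → (n₁ : ℝ) < bigT D → ∀ l₁ ∈ n₁.divisors,
      ‖(∑ l ∈ (Finset.Ico 1 ⌈2 * bigT D ^ 2⌉₊).filter (fun l => Nat.Coprime l (frakq D)),
          varpi2loc c' χ j l / ((l : ℂ) * (((l₁ * l : ℕ) : ℂ)) ^ beta3 c' D) *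
            (gstar D (bigT D ^ 2 / ((l₁ * l : ℕ) : ℝ)) : ℂ)) - 1‖ ≤ C * (ell D ^ 7)⁻¹

/-- **u037 REPAIRED (G-L4t5-1), local reading**: for each `n₁ ∈ 𝔫(𝔮)`, `n₁ < T`,
`Σ_{(n,𝔮)=1} b₁(n₁n)ϖ₂ⱼ^loc(n)/n = 𝔢ⱼ Σ_{m₁∣n₁} χ(m₁)τ₂(m₁) + O(τ₃(n₁)𝓛⁻⁷ + D^{−c})` — `Step16_u037R`
with `varpi2 ↦ varpi2loc`; this is the per-`n₁` input that `eq16_15_of_repairL` sums against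
`ϖ₂ⱼ(n₁)/n₁`. NOT PRINTED (G-L4t5-1 repaired reading × F16B-1 local reading). CLAIM.
[cite: Zhang2022LandauSiegel, §16 p.94 (u037), (16.14)] -/
def Step16_u037RL : Prop :=
  ∃ c : ℝ, 0 < c ∧ ∃ C : ℝ, ForAllLarge fun D _ χ => AssumptionA D χ → ∀ j ∈ ({1, 2} : Finset ℕ),
    ∀ n₁ : ℕ, n₁ ∈ nset (frakq D) → (n₁ : ℝ) < bigT D →
      ‖(∑ n ∈ (Finset.Ico 1 ⌈bigP D⌉₊).filter (fun n => Nat.Coprime n (frakq D)),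
          b1coef c' χ (n₁ * n) * varpi2loc c' χ j n / (n : ℂ)) -
        frake j * ∑ m₁ ∈ n₁.divisors, χ (m₁ : ZMod D) * (m₁.divisors.card : ℂ)‖ ≤
      C * (tau3R n₁ * (ell D ^ 7)⁻¹ + (D : ℝ) ^ (-c))

/-! ## The summed edge to (16.15) in the local reading (0 facts) -/

section EdgeL

/-- `τ₃(n) ≥ 0`. [folklore] -/
private theorem tau3R_nonneg' (n : ℕ) : 0 ≤ tau3R n :=
  Finset.sum_nonneg fun _ _ => Nat.cast_nonneg _

/-- `τ₃(n) ≥ 1` for `n ≥ 1`. [folklore] -/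
private theorem one_le_tau3R' {n : ℕ} (hn : 1 ≤ n) : 1 ≤ tau3R n := by
  unfold tau3R
  have h1 : (1 : ℕ) ∈ n.divisors := Nat.one_mem_divisors.mpr (by omega)
  calc (1 : ℝ) = ((1 : ℕ).divisors.card : ℝ) := by simp
    _ ≤ ∑ m ∈ n.divisors, (m.divisors.card : ℝ) :=
        Finset.single_le_sum (f := fun m : ℕ => (m.divisors.card : ℝ)) (fun _ _ => Nat.cast_nonneg _) h1

/-- `⌈e^L⌉ ≤ D ⇒ L ≤ 𝓛`. [folklore] -/
private theorem le_ell_of_ceil_exp_le' {L : ℝ} {D : ℕ} (hD : ⌈Real.exp L⌉₊ ≤ D) : L ≤ ell D := by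
  have h : Real.exp L ≤ D := le_trans (Nat.le_ceil _) (by exact_mod_cast hD)
  exact (Real.le_log_iff_exp_le (lt_of_lt_of_le (Real.exp_pos _) h)).mpr h

/-- `0 < 𝓛 ⇒ 0 < D`. [folklore] -/
private theorem cast_pos_of_ell_pos {D : ℕ} (hℓ : 0 < ell D) : (0 : ℝ) < D := by
  have : ell D ≠ 0 := hℓ.ne'
  rw [ell] at this
  by_contra h
  push Not at h
  have h0 : (D : ℝ) = 0 := le_antisymm h (Nat.cast_nonneg D)
  exact this (by rw [h0, Real.log_zero])

/-- `D^{−c} ≤ 1/(c𝓛)` (`c, 𝓛 > 0`). [folklore] -/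
private theorem rpow_neg_le_inv' {D : ℕ} {c : ℝ} (hc : 0 < c) (hℓ : 0 < ell D) :
    (D : ℝ) ^ (-c) ≤ (c * ell D)⁻¹ := by
  have hD := cast_pos_of_ell_pos hℓ
  rw [Real.rpow_def_of_pos hD, ← ell]
  have h1 := Real.add_one_le_exp (c * ell D)
  have hpos : 0 < c * ell D := mul_pos hc hℓ
  rw [show ell D * -c = -(c * ell D) by ring, Real.exp_neg]
  exact inv_anti₀ hpos (by linarith)

/-- `D^{−c}𝓛⁶ ≤ 7!/(c⁷𝓛)` (`c, 𝓛 > 0`). [folklore] -/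
private theorem rpow_neg_mul_pow_six_le' {D : ℕ} {c : ℝ} (hc : 0 < c) (hℓ : 0 < ell D) :
    (D : ℝ) ^ (-c) * ell D ^ 6 ≤ (Nat.factorial 7 : ℝ) / c ^ 7 * (ell D)⁻¹ := by
  have hD := cast_pos_of_ell_pos hℓ
  rw [Real.rpow_def_of_pos hD, ← ell, show ell D * -c = -(c * ell D) by ring, Real.exp_neg]
  have hpos : 0 < c * ell D := mul_pos hc hℓ
  have h7 := Real.pow_div_factorial_le_exp (c * ell D) (le_of_lt hpos) 7
  have hexp : (Real.exp (c * ell D))⁻¹ ≤ (Nat.factorial 7 : ℝ) / (c * ell D) ^ 7 := by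
    rw [inv_le_comm₀ (Real.exp_pos _) (by positivity), inv_div]
    exact h7
  calc (Real.exp (c * ell D))⁻¹ * ell D ^ 6 ≤ (Nat.factorial 7 : ℝ) / (c * ell D) ^ 7 * ell D ^ 6 := by
        gcongr
    _ = (Nat.factorial 7 : ℝ) / c ^ 7 * (ell D)⁻¹ := by
        field_simp

open scoped Classical in
/-- **The summed edge to (16.15) in the LOCAL reading (G-L4t5-1 × F16B-1)**: `Step16_u031L` (the
`𝔫(𝔮)`-decomposition with `ϖ₂ⱼ(n₁n) = ϖ₂ⱼ(n₁)ϖ₂ⱼ^loc(n)`), `Step16_u037RL` (the per-`n₁` evaluation of the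
rough sum) and the summed majorant `Inline16_varpi2WeightSum` (unchanged: it weighs the TRUE `ϖ₂ⱼ(n₁)`)
give the printed (16.15) `Eq16_15` with its `O(1/𝓛)` — the bookkeeping of `eq16_15_of_repair` verbatim
(`𝓛⁻⁷·𝓛⁶ = 𝓛⁻¹`, `D^{−c}𝓛⁶ ≤ 7!/(c⁷𝓛)`). [cite: Zhang2022LandauSiegel, §16 (16.15) p.94] -/
theorem eq16_15_of_repairL (h31 : Step16_u031L c') (h37 : Step16_u037RL c')
    (hS : Inline16_varpi2WeightSum c') : Eq16_15 c' := by
  obtain ⟨c₁, hc₁, C₁, D₁, h31⟩ := h31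
  obtain ⟨c₂, hc₂, C₂, D₂, h37⟩ := h37
  obtain ⟨C₃, D₃, hS⟩ := hS
  refine ⟨|C₁| / c₁ + |C₂| * |C₃| * (1 + (Nat.factorial 7 : ℝ) / c₂ ^ 7),
    max (max D₁ D₂) (max D₃ ⌈Real.exp 1⌉₊), fun D _ χ hD hq hp hA j hj => ?_⟩
  have hD₁ : D₁ ≤ D := le_trans (le_trans (le_max_left _ _) (le_max_left _ _)) hD
  have hD₂ : D₂ ≤ D := le_trans (le_trans (le_max_right _ _) (le_max_left _ _)) hD
  have hD₃ : D₃ ≤ D := le_trans (le_trans (le_max_left _ _) (le_max_right _ _)) hD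
  have hℓ1 : 1 ≤ ell D :=
    le_ell_of_ceil_exp_le' (le_trans (le_trans (le_max_right _ _) (le_max_right _ _)) hD)
  have hℓ0 : 0 < ell D := by linarith
  have e31 := h31 D χ hD₁ hq hp hA j hj
  have eS := hS D χ hD₃ hq hp hA j hj
  -- notation
  set F := (Finset.Ico 1 ⌈bigT D⌉₊).filter (fun n₁ => n₁ ∈ nset (frakq D)) with hF
  set X := ∑ n ∈ Finset.Ico 1 ⌈bigP D⌉₊, b1coef c' χ n * varpi2 c' χ j n / (n : ℂ) with hX
  set In : ℕ → ℂ := fun n₁ =>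
    ∑ n ∈ (Finset.Ico 1 ⌈bigP D⌉₊).filter (fun n => Nat.Coprime n (frakq D)),
      b1coef c' χ (n₁ * n) * varpi2loc c' χ j n / (n : ℂ) with hIn
  -- the per-`n₁` bound
  have e37 : ∀ n₁ ∈ F, ‖In n₁ - frake j * nuConvChi χ n₁‖ ≤
      |C₂| * (tau3R n₁ * (ell D ^ 7)⁻¹ + (D : ℝ) ^ (-c₂)) := by
    intro n₁ hn₁
    obtain ⟨hIco, hns⟩ := Finset.mem_filter.mp hn₁
    have h1 : 1 ≤ n₁ := (Finset.mem_Ico.mp hIco).1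
    have hT : (n₁ : ℝ) < bigT D := Nat.lt_ceil.mp (Finset.mem_Ico.mp hIco).2
    have key := h37 D χ hD₂ hq hp hA j hj n₁ hns hT
    rw [nuConvChi_eq_sum_divisors χ h1]
    refine le_trans key (mul_le_mul_of_nonneg_right (le_abs_self C₂) ?_)
    have := tau3R_nonneg' n₁
    positivity
  -- rewrite the difference
  have hsplit : X - frake j * ∑ n₁ ∈ F, varpi2 c' χ j n₁ * nuConvChi χ n₁ / (n₁ : ℂ) =
      (X - ∑ n₁ ∈ F, varpi2 c' χ j n₁ / (n₁ : ℂ) * In n₁) +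
        ∑ n₁ ∈ F, varpi2 c' χ j n₁ / (n₁ : ℂ) * (In n₁ - frake j * nuConvChi χ n₁) := by
    have e1 : ∑ n₁ ∈ F, varpi2 c' χ j n₁ / (n₁ : ℂ) * (In n₁ - frake j * nuConvChi χ n₁) =
        ∑ n₁ ∈ F, varpi2 c' χ j n₁ / (n₁ : ℂ) * In n₁ -
          ∑ n₁ ∈ F, varpi2 c' χ j n₁ / (n₁ : ℂ) * (frake j * nuConvChi χ n₁) := by
      rw [← Finset.sum_sub_distrib]
      exact Finset.sum_congr rfl fun _ _ => by ring
    have e2 : frake j * ∑ n₁ ∈ F, varpi2 c' χ j n₁ * nuConvChi χ n₁ / (n₁ : ℂ) =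
        ∑ n₁ ∈ F, varpi2 c' χ j n₁ / (n₁ : ℂ) * (frake j * nuConvChi χ n₁) := by
      rw [Finset.mul_sum]
      exact Finset.sum_congr rfl fun _ _ => by ring
    rw [e1, e2]
    ring
  rw [hsplit]
  -- main estimate
  have hterm : ∀ n₁ ∈ F, ‖varpi2 c' χ j n₁ / (n₁ : ℂ) * (In n₁ - frake j * nuConvChi χ n₁)‖ ≤
      ‖varpi2 c' χ j n₁‖ * tau3R n₁ / n₁ * (|C₂| * (ell D ^ 7)⁻¹) +
        ‖varpi2 c' χ j n₁‖ * tau3R n₁ / n₁ * (|C₂| * (D : ℝ) ^ (-c₂)) := by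
    intro n₁ hn₁
    obtain ⟨hIco, _⟩ := Finset.mem_filter.mp hn₁
    have h1 : 1 ≤ n₁ := (Finset.mem_Ico.mp hIco).1
    have hn0 : (0 : ℝ) < n₁ := by exact_mod_cast h1
    rw [norm_mul, norm_div, Complex.norm_natCast]
    have hτ := one_le_tau3R' h1
    have hϖ : 0 ≤ ‖varpi2 c' χ j n₁‖ / n₁ := by positivity
    calc ‖varpi2 c' χ j n₁‖ / ↑n₁ * ‖In n₁ - frake j * nuConvChi χ n₁‖
        ≤ ‖varpi2 c' χ j n₁‖ / ↑n₁ * (|C₂| * (tau3R n₁ * (ell D ^ 7)⁻¹ + (D : ℝ) ^ (-c₂))) :=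
          mul_le_mul_of_nonneg_left (e37 n₁ hn₁) hϖ
      _ = ‖varpi2 c' χ j n₁‖ * tau3R n₁ / n₁ * (|C₂| * (ell D ^ 7)⁻¹) +
            ‖varpi2 c' χ j n₁‖ / n₁ * (|C₂| * (D : ℝ) ^ (-c₂)) := by ring
      _ ≤ ‖varpi2 c' χ j n₁‖ * tau3R n₁ / n₁ * (|C₂| * (ell D ^ 7)⁻¹) +
            ‖varpi2 c' χ j n₁‖ * tau3R n₁ / n₁ * (|C₂| * (D : ℝ) ^ (-c₂)) := by
          have hdiv : ‖varpi2 c' χ j n₁‖ / n₁ ≤ ‖varpi2 c' χ j n₁‖ * tau3R n₁ / n₁ := by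
            apply div_le_div_of_nonneg_right _ hn0.le
            calc ‖varpi2 c' χ j n₁‖ = ‖varpi2 c' χ j n₁‖ * 1 := (mul_one _).symm
              _ ≤ ‖varpi2 c' χ j n₁‖ * tau3R n₁ := mul_le_mul_of_nonneg_left hτ (norm_nonneg _)
          have hD0 : 0 ≤ |C₂| * (D : ℝ) ^ (-c₂) :=
            mul_nonneg (abs_nonneg _) (Real.rpow_nonneg (Nat.cast_nonneg D) _)
          have := mul_le_mul_of_nonneg_right hdiv hD0
          linarith
  have hsumS : 0 ≤ ∑ n₁ ∈ F, ‖varpi2 c' χ j n₁‖ * tau3R n₁ / n₁ :=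
    Finset.sum_nonneg fun n₁ _ => by
      have := tau3R_nonneg' n₁; positivity
  have eS' : ∑ n₁ ∈ F, ‖varpi2 c' χ j n₁‖ * tau3R n₁ / n₁ ≤ |C₃| * ell D ^ 6 :=
    le_trans eS (mul_le_mul_of_nonneg_right (le_abs_self C₃) (by positivity))
  have hexp1 : (D : ℝ) ^ (-c₁) ≤ (c₁ * ell D)⁻¹ := rpow_neg_le_inv' hc₁ hℓ0
  have hexp2 : (D : ℝ) ^ (-c₂) * ell D ^ 6 ≤ (Nat.factorial 7 : ℝ) / c₂ ^ 7 * (ell D)⁻¹ :=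
    rpow_neg_mul_pow_six_le' hc₂ hℓ0
  have hDc₁ : 0 ≤ (D : ℝ) ^ (-c₁) := Real.rpow_nonneg (Nat.cast_nonneg D) _
  have hDc₂ : 0 ≤ (D : ℝ) ^ (-c₂) := Real.rpow_nonneg (Nat.cast_nonneg D) _
  calc ‖(X - ∑ n₁ ∈ F, varpi2 c' χ j n₁ / (n₁ : ℂ) * In n₁) +
          ∑ n₁ ∈ F, varpi2 c' χ j n₁ / (n₁ : ℂ) * (In n₁ - frake j * nuConvChi χ n₁)‖
      ≤ ‖X - ∑ n₁ ∈ F, varpi2 c' χ j n₁ / (n₁ : ℂ) * In n₁‖ +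
          ∑ n₁ ∈ F, ‖varpi2 c' χ j n₁ / (n₁ : ℂ) * (In n₁ - frake j * nuConvChi χ n₁)‖ :=
        le_trans (norm_add_le _ _) (by gcongr; exact norm_sum_le _ _)
    _ ≤ C₁ * (D : ℝ) ^ (-c₁) +
          ∑ n₁ ∈ F, (‖varpi2 c' χ j n₁‖ * tau3R n₁ / n₁ * (|C₂| * (ell D ^ 7)⁻¹) +
            ‖varpi2 c' χ j n₁‖ * tau3R n₁ / n₁ * (|C₂| * (D : ℝ) ^ (-c₂))) :=
        add_le_add e31 (Finset.sum_le_sum hterm)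
    _ = C₁ * (D : ℝ) ^ (-c₁) +
          (∑ n₁ ∈ F, ‖varpi2 c' χ j n₁‖ * tau3R n₁ / n₁) *
            (|C₂| * (ell D ^ 7)⁻¹ + |C₂| * (D : ℝ) ^ (-c₂)) := by
        rw [Finset.sum_add_distrib, ← Finset.sum_mul, ← Finset.sum_mul]; ring
    _ ≤ |C₁| * (D : ℝ) ^ (-c₁) +
          (|C₃| * ell D ^ 6) * (|C₂| * (ell D ^ 7)⁻¹ + |C₂| * (D : ℝ) ^ (-c₂)) := by
        have i1 : C₁ * (D : ℝ) ^ (-c₁) ≤ |C₁| * (D : ℝ) ^ (-c₁) :=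
          mul_le_mul_of_nonneg_right (le_abs_self _) hDc₁
        have i2 : (∑ n₁ ∈ F, ‖varpi2 c' χ j n₁‖ * tau3R n₁ / n₁) *
              (|C₂| * (ell D ^ 7)⁻¹ + |C₂| * (D : ℝ) ^ (-c₂)) ≤
            (|C₃| * ell D ^ 6) * (|C₂| * (ell D ^ 7)⁻¹ + |C₂| * (D : ℝ) ^ (-c₂)) :=
          mul_le_mul_of_nonneg_right eS' (by positivity)
        linarith
    _ = |C₁| * (D : ℝ) ^ (-c₁) + |C₂| * |C₃| * (ell D ^ 6 * (ell D ^ 7)⁻¹) +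
          |C₂| * |C₃| * ((D : ℝ) ^ (-c₂) * ell D ^ 6) := by ring
    _ ≤ |C₁| * (c₁ * ell D)⁻¹ + |C₂| * |C₃| * (ell D)⁻¹ +
          |C₂| * |C₃| * ((Nat.factorial 7 : ℝ) / c₂ ^ 7 * (ell D)⁻¹) := by
        have e6 : ell D ^ 6 * (ell D ^ 7)⁻¹ = (ell D)⁻¹ := by
          rw [show ell D ^ 7 = ell D ^ 6 * ell D by ring, mul_inv, ← mul_assoc,
            mul_inv_cancel₀ (pow_ne_zero 6 hℓ0.ne'), one_mul]
        rw [e6]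
        have i1 := mul_le_mul_of_nonneg_left hexp1 (abs_nonneg C₁)
        have i3 := mul_le_mul_of_nonneg_left hexp2 (mul_nonneg (abs_nonneg C₂) (abs_nonneg C₃))
        linarith
    _ = (|C₁| / c₁ + |C₂| * |C₃| * (1 + (Nat.factorial 7 : ℝ) / c₂ ^ 7)) * (ell D)⁻¹ := by
        field_simp
        ring

end EdgeL

end Literature.NumberTheory.LFunctions.Zhang2022.Typed.Section16B
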